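import Summits.QuantumAdvantage.QuantumAdvantage.Theorems.AvgFaceBeyondPrior.Negative.AvgFaceBeyondPriorNecessary
import Summits.QuantumAdvantage.QuantumAdvantage.Theorems.AvgFaceBeyondPrior.Negative.AvgFaceBeyondPriorBlocks
import Summits.QuantumAdvantage.QuantumAdvantage.Theorems.AvgFaceBeyondPrior.Negative.AvgFaceBeyondPriorOften

/-!
# `AvgFaceBeyondPrior` (stmt-QuantumAdvantage-2427): the arithmetic × complexity split

Crux-strategist file (route `ArithStatLadder`, crux `AvgFaceBeyondPrior` = `(IQ3, U) ∉ Heur_{1/3}BPP`,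
`IQ3 = {bin d : −d fundamental, 3 ∣ h(−d)}`, `Uₙ` uniform on the n-bit `d` with `−d` fundamental).

Every checked line for this crux died at a stub conjoining TWO debts of different nature
(`Lines/*dead.md`): a computational one (no PPT statistic of `d` is correlated with the 3-torsion —
hypothesis-type) and an arithmetic one (enough fundamental `−d` have `3 ∣ h(−d)` — open arithmetic
statistics, reached in those lines only through an unproved SECOND MOMENT of `#Cl₃`). This file proves
the sufficiency of the split that separates the two debts at their joint and drops the second moment:

* `DensityFloor`  (arithmetic statistics, NECESSARY up to the margin `η` by the landed
  `Negative.avgFace_imp_exists_level_ge`): for some `η > 0`, beyond every level `N` there is a block with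
  `#{d ∈ 𝒟ₙ : 3 ∣ h(−d)} ≥ (1/3 + η)·#𝒟ₙ` (Cohen–Lenstra: `→ 0.43987`; in print not even a positive
  proportion of `3 ∣ h(−d)` is known);
* `DensityCeiling` (Davenport–Heilbronn, printed theorem; in the tree as
  `DeltaCeiling.card_three_dvd_le_of_dh` modulo the named fact `bst_threeTorsion_mean`): eventually
  `#{3 ∣ h} ≤ (1/2 + ε)·#𝒟ₙ`;
* `PriorOptimal`   (computational Cohen–Lenstra, hypothesis-type): no PPT `A(x, 1ⁿ)` has bad `Uₙ`-count
  (coin error `≥ 1/4`, the crux's own bad event) below that of the better CONSTANT predictor by `η·#𝒟ₙ`,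
  eventually in `n` — self-normalised by the unknown density, so it needs no moment input, and by itself
  it is NOT known to imply `IQ3 ∉ BPP` (that needs the floor: positive proportion is open).

`AvgFaceBeyondPrior_of_subs : DensityFloor → DensityCeiling → PriorOptimal → AvgFaceBeyondPrior`
(hypotheses spelled with the route's literal block / language, so that the three become route items
verbatim). Proof: for a PPT `A`, take `θ = min η 1/12`; eventually (prior-optimality at `θ/2`, ceiling at
`1/12`) and at a floor level `n ≥ 2` beyond that, `#bad ≥ min(#T, #𝒟 − #T) − (θ/2)#𝒟 ≥ (1/3 + θ/2)#𝒟 >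
#𝒟/3`, i.e. bad mass `> 1/3` (`Negative.ens_prob_eq`), which is the crux unfolded (`Negative.avgFace_iff`).
(planner-cstrat-stmt-QuantumAdvantage-2427-p1-0, 2026-08-17.)
-/

set_option linter.dupNamespace false

noncomputable section

namespace Summit.QuantumAdvantage.QuantumAdvantage.Theorems.AvgFaceBeyondPrior.Split

open Filter Finset
open scoped Classical
open _root_.Computability Literature.Computability.Complexity Literature.Computability.MetaComplexity
open Literature.NumberTheory.QuadraticFields
open Summit.QuantumAdvantage.QuantumAdvantage.Theorems.AvgFaceBeyondPrior
open Summit.QuantumAdvantage.QuantumAdvantage.Theses.ArithStatLadder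

/-- The route's literal predicate "`−d` is a fundamental discriminant" (notation, no declaration). -/
local notation "IsFundNegL(" d ")" =>
  ((((-(d:ℤ)) % 4 = 1 ∧ Squarefree (-(d:ℤ)) ∧ (-(d:ℤ)) ≠ 1) ∨
    (4 ∣ (-(d:ℤ)) ∧ ((-(d:ℤ)) / 4 % 4 = 2 ∨ (-(d:ℤ)) / 4 % 4 = 3) ∧ Squarefree ((-(d:ℤ)) / 4))))

/-- The route's literal dyadic block `𝒟ₙ` of n-bit `d` with `−d` fundamental (notation, no declaration). -/
local notation "𝒟(" n ")" =>
  (Finset.filter (fun d : ℕ => IsFundNegL(d)) (Finset.Ico (2 ^ (n - 1)) (2 ^ n)))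

/-- The part of the block with `3 ∣ h(−d)` (notation, no declaration). -/
local notation "𝒯(" n ")" =>
  (Finset.filter (fun d : ℕ => 3 ∣ Literature.NumberTheory.QuadraticFields.BinaryQuadraticForm.classNumber (-(d:ℤ))) (𝒟(n)))

set_option quotPrecheck false in
/-- The route's literal language `IQ3` (notation, no declaration). -/
local notation "IQ3L" =>
  (Computability.encodingNatBool.toLanguage
    (setOf (fun d : ℕ => IsFundNegL(d) ∧ 3 ∣ Literature.NumberTheory.QuadraticFields.BinaryQuadraticForm.classNumber (-(d:ℤ)))))

/-- **Sufficiency of the split**: density floor `> 1/3` infinitely often ∧ Davenport–Heilbronn ceiling ∧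
prior-optimality of PPT predictors ⟹ the crux `AvgFaceBeyondPrior`. The three hypotheses are, verbatim,
the sub-crux statements `IqThreeDensityFloor`, `IqThreeDensityCeiling`, `IqThreePriorOptimal` filed on
route `ArithStatLadder`. [cite: BogdanovTrevisan2006, Def. 2.13] [cite: CohenLenstra1984, §9 (C2)]
[cite: DavenportHeilbronn1971, Thm 3] -/
theorem AvgFaceBeyondPrior_of_subs
    (hFloor : ∃ η : ℝ, 0 < η ∧ ∀ N : ℕ, ∃ n : ℕ, N ≤ n ∧
      (1 / 3 + η) * (Finset.card (𝒟(n)) : ℝ) ≤ (Finset.card (𝒯(n)) : ℝ))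
    (hCeil : ∀ ε : ℝ, 0 < ε → ∀ᶠ n : ℕ in Filter.atTop,
      (Finset.card (𝒯(n)) : ℝ) ≤ (1 / 2 + ε) * (Finset.card (𝒟(n)) : ℝ))
    (hPrior : ∀ A : Literature.Computability.Complexity.RandAlg (List Bool × ℕ) Bool,
      A.IsPolyTime Literature.Computability.MetaComplexity.paramEnc Computability.encodeBool →
      ∀ η : ℝ, 0 < η → ∀ᶠ n : ℕ in Filter.atTop,
        min (Finset.card (𝒯(n)) : ℝ) ((Finset.card (𝒟(n)) : ℝ) - (Finset.card (𝒯(n)) : ℝ)) - η * (Finset.card (𝒟(n)) : ℝ) ≤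
          (Finset.card (Finset.filter (fun d : ℕ => (1 : ℝ) / 4 ≤
              A.pr Literature.Computability.MetaComplexity.paramEnc (Computability.encodeNat d, n)
                {b : Bool | b ≠ (IQ3L).boolIndicator (Computability.encodeNat d)}) (𝒟(n))) : ℝ)) :
    AvgFaceBeyondPrior := by
  rw [Negative.avgFace_iff]
  intro A hA
  obtain ⟨η, hη, hFreq⟩ := hFloor
  set θ : ℝ := min η (1 / 12) with hθdef
  have hθpos : 0 < θ := lt_min hη (by norm_num)
  have hθη : θ ≤ η := min_le_left _ _
  have hθ12 : θ ≤ 1 / 12 := min_le_right _ _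
  have hP := hPrior A hA (θ / 2) (by positivity)
  have hC := hCeil (1 / 12) (by norm_num)
  obtain ⟨N, hN⟩ := Filter.eventually_atTop.1 (hP.and hC)
  obtain ⟨n, hn, hfl⟩ := hFreq (max N 2)
  have hn2 : 2 ≤ n := le_trans (le_max_right _ _) hn
  have hnN : N ≤ n := le_trans (le_max_left _ _) hn
  obtain ⟨hPn, hCn⟩ := hN n hnN
  have hne : (Negative.fundBlock n).Nonempty := Negative.Blocks.fundBlock_nonempty hn2
  refine ⟨n, ?_⟩
  rw [Negative.ens_prob_eq hne]
  have hcard : (0:ℝ) < (Negative.fundBlock n).card := by exact_mod_cast hne.card_pos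
  rw [lt_div_iff₀ hcard]
  -- the prior-optimality bad count is at most the bad count of `ens_prob_eq` (same event)
  have hsub : (Finset.filter (fun d : ℕ => (1 : ℝ) / 4 ≤
      A.pr Literature.Computability.MetaComplexity.paramEnc (Computability.encodeNat d, n)
        {b : Bool | b ≠ (IQ3L).boolIndicator (Computability.encodeNat d)}) (𝒟(n))) ⊆
      ((Negative.fundBlock n).filter fun d => encodeNat d ∈
        {x | (1:ℝ) / 4 ≤ A.pr paramEnc (x, n) {b | b ≠ Negative.iq3Lang.boolIndicator x}}) := by
    intro d hd
    rw [Finset.mem_filter] at hd ⊢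
    exact ⟨hd.1, hd.2⟩
  have hle := Finset.card_le_card hsub
  have hle' : ((Finset.card (Finset.filter (fun d : ℕ => (1 : ℝ) / 4 ≤
      A.pr Literature.Computability.MetaComplexity.paramEnc (Computability.encodeNat d, n)
        {b : Bool | b ≠ (IQ3L).boolIndicator (Computability.encodeNat d)}) (𝒟(n))) : ℝ)) ≤
      ((((Negative.fundBlock n).filter fun d => encodeNat d ∈
        {x | (1:ℝ) / 4 ≤ A.pr paramEnc (x, n) {b | b ≠ Negative.iq3Lang.boolIndicator x}}).card : ℝ)) := by
    exact_mod_cast hle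
  -- rename the counts
  set D : ℝ := (Finset.card (𝒟(n)) : ℝ) with hDdef
  set T : ℝ := (Finset.card (𝒯(n)) : ℝ) with hTdef
  have hDpos : 0 < D := hcard
  -- floor with margin θ, ceiling 7/12
  have hT1 : (1 / 3 + θ) * D ≤ T := by
    have : (1 / 3 + θ) * D ≤ (1 / 3 + η) * D := by nlinarith
    exact this.trans hfl
  have hT2 : (1 / 3 + θ) * D ≤ D - T := by nlinarith
  have hmin : (1 / 3 + θ) * D ≤ min T (D - T) := le_min hT1 hT2
  have hbad : (1 / 3 + θ / 2) * D ≤ min T (D - T) - θ / 2 * D := by nlinarith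
  have hfinal := (hbad.trans hPn).trans hle'
  have hlt : 1 / 3 * D < (1 / 3 + θ / 2) * D := by nlinarith
  exact lt_of_lt_of_le hlt hfinal

/-- **The floor is necessary up to its margin**: the crux forces, beyond every level `N`, a block
with `#{3 ∣ h(−d)} > (1/3)·#𝒟ₙ` — the `η = 0` form of `IqThreeDensityFloor` (re-typing of the landed
`Negative.avgFace_imp_exists_level_ge`: the finitely patched constant predictor `3 ∤ h` is PPT). So the split
loses at most the margin `η > 0` on the arithmetic side. [cite: CohenLenstra1984, §9 (C2)] -/
theorem floor_noMargin_of_avgFace (h : AvgFaceBeyondPrior) (N : ℕ) :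
    ∃ n : ℕ, N ≤ n ∧ (1 / 3) * (Finset.card (𝒟(n)) : ℝ) < (Finset.card (𝒯(n)) : ℝ) := by
  obtain ⟨n, hn, -, hlt⟩ := Negative.avgFace_imp_exists_level_ge h N
  exact ⟨n, hn, by
    have h' : ((Negative.fundBlock n).card : ℝ) <
        3 * ((Negative.fundBlock n).filter fun d : ℕ =>
          3 ∣ BinaryQuadraticForm.classNumber (-(d:ℤ))).card := hlt
    change (1 / 3) * ((Negative.fundBlock n).card : ℝ) <
      (((Negative.fundBlock n).filter fun d : ℕ => 3 ∣ BinaryQuadraticForm.classNumber (-(d:ℤ))).card : ℝ)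
    linarith⟩

/-- **Sanity of the prior-optimality inequality** (its bad event is the crux's, and the bound is met with
equality-in-kind by a constant predictor): for the constant-`false` PPT predictor "`3 ∤ h`" the bad inputs of
a block are exactly those with `3 ∣ h(−d)` (`Negative.badSet_constFalse`), so its bad count `#𝒯ₙ` is
`≥ min(#𝒯ₙ, #𝒟ₙ − #𝒯ₙ) − η·#𝒟ₙ` at EVERY level, for every `η ≥ 0`: `IqThreePriorOptimal` is not refuted by
the trivial predictors and is tight for them. [cite: BogdanovTrevisan2006, Def. 2.13] -/
theorem priorOptimal_constFalse (n : ℕ) {η : ℝ} (hη : 0 ≤ η) :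
    min (Finset.card (𝒯(n)) : ℝ) ((Finset.card (𝒟(n)) : ℝ) - (Finset.card (𝒯(n)) : ℝ))
        - η * (Finset.card (𝒟(n)) : ℝ) ≤
      (Finset.card (Finset.filter (fun d : ℕ => (1 : ℝ) / 4 ≤
          Negative.constFalse.pr Literature.Computability.MetaComplexity.paramEnc (Computability.encodeNat d, n)
            {b : Bool | b ≠ (IQ3L).boolIndicator (Computability.encodeNat d)}) (𝒟(n))) : ℝ) := by
  have hfilter : Finset.filter (fun d : ℕ => (1 : ℝ) / 4 ≤
      Negative.constFalse.pr Literature.Computability.MetaComplexity.paramEnc (Computability.encodeNat d, n)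
        {b : Bool | b ≠ (IQ3L).boolIndicator (Computability.encodeNat d)}) (𝒟(n)) = 𝒯(n) := by
    refine Finset.filter_congr fun d hd => ?_
    have hx := Set.ext_iff.1 (Negative.badSet_constFalse n) (encodeNat d)
    simp only [Set.mem_setOf_eq] at hx
    change ((1 : ℝ) / 4 ≤ Negative.constFalse.pr paramEnc (encodeNat d, n)
      {b : Bool | b ≠ Negative.iq3Lang.boolIndicator (encodeNat d)}) ↔ _
    rw [hx, Negative.encodeNat_mem_iq3Lang]
    exact ⟨fun h => h.2, fun h => ⟨(Finset.mem_filter.1 hd).2, h⟩⟩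
  rw [hfilter]
  have hD : (0 : ℝ) ≤ (Finset.card (𝒟(n)) : ℝ) := by positivity
  have h1 := min_le_left (Finset.card (𝒯(n)) : ℝ) ((Finset.card (𝒟(n)) : ℝ) - (Finset.card (𝒯(n)) : ℝ))
  nlinarith

end Summit.QuantumAdvantage.QuantumAdvantage.Theorems.AvgFaceBeyondPrior.Split

end
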